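import Summits.NavierStokesRegularity.NavierStokesRegularity.Theses.TerminalTrace
import Summits.NavierStokesRegularity.NavierStokesRegularity.Theorems.TerminalTraceTraceDensityCriterionLocalTypeI
import HarnessLib

/-!
# Crux `TerminalTrace.NoTraceConcentration` (stmt-NavierStokesRegularity-18381) EXCLUDES LOCALLY TYPE-I SINGULAR POINTS:
# under crux B every vertex carrying the local Type-I rate is regular

Seat nsreg-C26-p1 g6 (cell ns-regularity-ideate), `--supports stmt-NavierStokesRegularity-18381` (helper; a strength record of
the crux, sharpening `TerminalTrace.noTypeIBlowup_of_noTraceConcentration` (p653125) from the global rate `IsTypeIBlowup u T`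
to the LOCAL rate of the cell's doors; nothing is closed).

* `TerminalTrace.localTypeI_regular_of_noTraceConcentration` — `NoTraceConcentration` ⇒ in the frame, every vertex `x₀` with
  `‖u(t,x)‖ √(ν(T−t)) ≤ M` on `(T − ρ², T) × B(x₀, ρ)` is backward bounded (the final-density door
  `TerminalTrace.localTypeI_traceDensityCriterion`, p655535, fed with FE(x₀) from crux B);
* `TerminalTrace.not_localTypeI_of_singular_of_noTraceConcentration` — contrapositive: under crux B a backward-singular vertex
  of a frame solution is NOT locally Type-I (every first-time singularity is locally Type-II at each of its singular points).

WHAT THIS IS NOT: not NS regularity, not crux B; implications from an OPEN statement. [folklore; EscauriazaSereginSverak2003 §3]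
-/

set_option linter.dupNamespace false

noncomputable section

open MeasureTheory Set Function Filter Topology Metric
open Literature.Analysis.FluidPDE

namespace Summit.NavierStokesRegularity.NavierStokesRegularity.Theorems

/-- **Crux B makes every locally Type-I vertex regular.** [folklore; EscauriazaSereginSverak2003 §3] -/
theorem TerminalTrace.localTypeI_regular_of_noTraceConcentration
    (hB : Summit.NavierStokesRegularity.NavierStokesRegularity.Theses.TerminalTrace.NoTraceConcentration)
    {ν T : ℝ} (hν : 0 < ν) (hT : 0 < T)
    {u : ℝ → EuclideanSpace ℝ (Fin 3) → EuclideanSpace ℝ (Fin 3)} {p : ℝ → EuclideanSpace ℝ (Fin 3) → ℝ}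
    (hcl : IsClassicalNSSolutionOn (Ico 0 T) ν 0 u p) (hLH : IsLerayHopfOn T ν 0 (u 0) u)
    (hdec : HasRapidSpatialDecay (u 0)) {x₀ : EuclideanSpace ℝ (Fin 3)} {ρ M : ℝ} (hρ : 0 < ρ)
    (hM : ∀ t ∈ Ico 0 T, T - ρ ^ 2 < t → ∀ x ∈ ball x₀ ρ, ‖u t x‖ * Real.sqrt (ν * (T - t)) ≤ M) :
    IsBackwardBoundedAt u T x₀ :=
  TerminalTrace.localTypeI_traceDensityCriterion ν T hν hT u p hcl hLH hdec x₀ ρ M hρ hM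
    (hB ν T hν hT u p hcl hLH hdec x₀)

/-- **Under crux B, a backward-singular vertex is not locally Type-I**: if `u` is essentially unbounded on every
`Q_r(T, x₀)`, then no local rate `‖u(t,x)‖ √(ν(T−t)) ≤ M` holds on any `(T − ρ², T) × B(x₀, ρ)`.
[folklore; EscauriazaSereginSverak2003 §3] -/
theorem TerminalTrace.not_localTypeI_of_singular_of_noTraceConcentration
    (hB : Summit.NavierStokesRegularity.NavierStokesRegularity.Theses.TerminalTrace.NoTraceConcentration)
    {ν T : ℝ} (hν : 0 < ν) (hT : 0 < T)
    {u : ℝ → EuclideanSpace ℝ (Fin 3) → EuclideanSpace ℝ (Fin 3)} {p : ℝ → EuclideanSpace ℝ (Fin 3) → ℝ}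
    (hcl : IsClassicalNSSolutionOn (Ico 0 T) ν 0 u p) (hLH : IsLerayHopfOn T ν 0 (u 0) u)
    (hdec : HasRapidSpatialDecay (u 0)) {x₀ : EuclideanSpace ℝ (Fin 3)}
    (hsing : ∀ r : ℝ, 0 < r → eLpNorm (uncurry u) ⊤ (volume.restrict (parabolicCylinder r (T, x₀))) = ⊤)
    {ρ M : ℝ} (hρ : 0 < ρ) :
    ¬ (∀ t ∈ Ico 0 T, T - ρ ^ 2 < t → ∀ x ∈ ball x₀ ρ, ‖u t x‖ * Real.sqrt (ν * (T - t)) ≤ M) := by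
  intro hM
  obtain ⟨r, hr, hfin⟩ :=
    (TerminalTrace.localTypeI_regular_of_noTraceConcentration hB hν hT hcl hLH hdec hρ hM).eLpNorm_parabolicCylinder_lt_top
  exact hfin.ne (hsing r hr)

end Summit.NavierStokesRegularity.NavierStokesRegularity.Theorems

end
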